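import Literature.MathematicalPhysics.QuantumLattice.FinDimSpectrum
import Literature.MathematicalPhysics.QuantumLattice.FinDimSpectrumSectorGibbsLimit
import Literature.MathematicalPhysics.QuantumLattice.SectorGroundProjContinuity
import Literature.MathematicalPhysics.QuantumChemistry.CharacterSectorRayleighRitz

/-!
# Sketch — grand-canonical wrapper for the odd-deformation transfer (hub-lb-sym-idea-4 g0,
contribution to LINE symidea1-L1 «ODD-DEF» of hub-lb-sym-idea-1; crux `LowerEdge_ge_m4o5`)

For a CHARGED odd deformation (pairing field `V_Δ`, charge ±2, `g = exp(iπN/2)`) the compression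
of `V_Δ` to a fixed-`N` sector vanishes, so the transfer `E_K(H+εV) ≤ E_K(H)` of
`OddDeformation.OddDeformationTransfer` is used with `K := ⊤` and `H := H - μ•N` (which still
commutes with `g`), and the fixed-`N*` sector energy is recovered by the elementary
sector-to-grand-canonical inequality `E_⊤(H - μN) ≤ E_{K}(H) - μ N*` (`sector_to_grandCanonical`,
PROVED here from the tree's `minEnergyOn_le_minEnergyOn_of_le`, `minEnergyOn_le_rayleigh_of_mem`,
`exists_unit_eigen_minEnergyOn`). Composition `lowerBound_transfer_gc` is PROVED modulo ONLY
sym-idea-1's `OddDeformationTransfer`: any certified lower bound `c` for `H - μN + εV` on the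
whole Fock space gives `c + μN* ≤ E_{K}(H)` on every `H`-invariant sector `K ≠ ⊥` with `N = N*`,
for every `μ, ε`.
HONEST FRAMING: bookkeeping glue for an ideation line; no bound, no number; nothing here predicts
superconductivity.
-/

namespace Summit.Ventures.CertifiedManyBodySolver.Cruxes.LowerEdge_ge_m4o5.OddDeformationGC

open Matrix

/-- VERBATIM COPY of `…Cruxes.LowerEdge_ge_m4o5.OddDeformation.OddDeformationTransfer`
(hub-lb-sym-idea-1, SketchOddDeformation.lean, crux write c68bc9f0538f) — restated here only
because crux workfiles are not importable library modules on the farm; the two `Prop`s are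
syntactically identical. If a unitary `g` preserves `K`, commutes with `H` and anticommutes with
`V`, then `E_K(H + εV) ≤ E_K(H)`. -/
def OddDeformationTransfer : Prop :=
  ∀ (n : Type) [Fintype n] [DecidableEq n] (H V g : Matrix n n ℂ) (K : Submodule ℂ (n → ℂ)),
    H.IsHermitian → V.IsHermitian → gᴴ * g = 1 → g * H = H * g → g * V = -(V * g) →
    (∀ ψ ∈ K, g *ᵥ ψ ∈ K) →
    ∀ ε : ℝ, (H + (ε : ℂ) • V).minEnergyOn K ≤ H.minEnergyOn K

/-- Sector → grand-canonical step (PROVED). If `Nop` acts as the scalar `N*` on the `H`-invariant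
sector `K ≠ ⊥`, then the whole-space minimum of `H - μ•Nop` is at most the sector minimum of `H`
minus `μ N*`: a unit minimiser `ψ ∈ K` of `H` (exists by `exists_unit_eigen_minEnergyOn`) is a
trial state for `H - μ•Nop` on `⊤ ≥ K` with Rayleigh quotient `E_K(H) - μ N*`. -/
theorem sector_to_grandCanonical {n : Type} [Fintype n] [DecidableEq n] (H Nop : Matrix n n ℂ)
    (K : Submodule ℂ (n → ℂ)) (μ Nstar : ℝ) (hH : H.IsHermitian)
    (hHμ : (H - ((μ : ℝ) : ℂ) • Nop).IsHermitian) (hKH : ∀ v ∈ K, H *ᵥ v ∈ K)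
    (hK : ∀ ψ ∈ K, Nop *ᵥ ψ = ((Nstar : ℝ) : ℂ) • ψ) (hK0 : K ≠ ⊥) :
    (H - ((μ : ℝ) : ℂ) • Nop).minEnergyOn ⊤ ≤ H.minEnergyOn K - μ * Nstar := by
  obtain ⟨ψ, hψK, hψ1, hHψ⟩ :=
    Literature.MathematicalPhysics.QuantumLattice.exists_unit_eigen_minEnergyOn hH K hKH hK0
  have h1 : (H - ((μ : ℝ) : ℂ) • Nop).minEnergyOn ⊤ ≤ (H - ((μ : ℝ) : ℂ) • Nop).minEnergyOn K :=
    Literature.MathematicalPhysics.QuantumChemistry.minEnergyOn_le_minEnergyOn_of_le hHμ le_top hK0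
  have h2 : (H - ((μ : ℝ) : ℂ) • Nop).minEnergyOn K ≤
      (star ψ ⬝ᵥ (H - ((μ : ℝ) : ℂ) • Nop) *ᵥ ψ).re :=
    Literature.MathematicalPhysics.QuantumLattice.minEnergyOn_le_rayleigh_of_mem hHμ K hψK hψ1
  have h3 : (H - ((μ : ℝ) : ℂ) • Nop) *ᵥ ψ =
      ((H.minEnergyOn K : ℝ) : ℂ) • ψ - ((μ : ℝ) : ℂ) • (((Nstar : ℝ) : ℂ) • ψ) := by
    rw [Matrix.sub_mulVec, Matrix.smul_mulVec, hHψ, hK ψ hψK]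
  have h4 : (star ψ ⬝ᵥ (H - ((μ : ℝ) : ℂ) • Nop) *ᵥ ψ).re = H.minEnergyOn K - μ * Nstar := by
    rw [h3, dotProduct_sub, dotProduct_smul, dotProduct_smul, dotProduct_smul, hψ1]
    simp [Complex.mul_re]
  linarith

/-- GRAND-CANONICAL ODD-DEFORMATION TRANSFER (proved from the two `Prop`s). `g` unitary commutes
with `H` and with the number operator `Nop`, anticommutes with the (charged) deformation `V`;
then for every chemical potential `μ` and coupling `ε`, a lower bound `c` for `H - μ Nop + ε V` on
the whole space yields `c + μ N* ≤ E_{K}(H)` on any `H`-invariant sector `K ≠ ⊥` where `Nop = N*`. With `H` the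
`L×L` torus Hubbard Hamiltonian, `K` its `(N↑,N↓)` sector and `c = L²·(certificate value)`, the
existing thermodynamic-limit transport applies unchanged. -/
theorem lowerBound_transfer_gc (hT : OddDeformationTransfer)
    {n : Type} [Fintype n] [DecidableEq n] (H Nop V g : Matrix n n ℂ)
    (K : Submodule ℂ (n → ℂ)) (μ Nstar ε c : ℝ) (hH : H.IsHermitian)
    (hHμ : (H - ((μ : ℝ) : ℂ) • Nop).IsHermitian) (hV : V.IsHermitian) (hg : gᴴ * g = 1)
    (hgH : g * H = H * g) (hgN : g * Nop = Nop * g) (hgV : g * V = -(V * g))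
    (hKH : ∀ v ∈ K, H *ᵥ v ∈ K) (hK : ∀ ψ ∈ K, Nop *ᵥ ψ = ((Nstar : ℝ) : ℂ) • ψ) (hK0 : K ≠ ⊥)
    (hc : c ≤ (H - ((μ : ℝ) : ℂ) • Nop + ((ε : ℝ) : ℂ) • V).minEnergyOn ⊤) :
    c + μ * Nstar ≤ H.minEnergyOn K := by
  have hcomm : g * (H - ((μ : ℝ) : ℂ) • Nop) = (H - ((μ : ℝ) : ℂ) • Nop) * g := by
    rw [Matrix.mul_sub, Matrix.sub_mul, hgH, Matrix.mul_smul, Matrix.smul_mul, hgN]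
  have h1 := hT n (H - ((μ : ℝ) : ℂ) • Nop) V g ⊤ hHμ hV hg hcomm hgV
    (fun ψ _ => Submodule.mem_top) ε
  have h2 := sector_to_grandCanonical H Nop K μ Nstar hH hHμ hKH hK hK0
  linarith

/-- ANALYTIC STAGE-0 FACT behind the pairing channel, in its scalar form: if the density row fixes
`ȳ(n_{x↑}) + ȳ(n_{x↓}) = nfill` then the forced first-order response of the on-site pair word is
`nfill - 1` (the CAR identity `[c†↑c†↓, c↓c↑] = n↑ + n↓ - 1` is the operator input; here only the
arithmetic that makes `nfill = 7/8` give `-1/8 ≠ 0`). -/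
theorem stage0_onsite_pair_forcing (nUp nDn nfill : ℚ) (h : nUp + nDn = nfill)
    (hfill : nfill = 7 / 8) : nUp + nDn - 1 = -(1 / 8 : ℚ) ∧ nUp + nDn - 1 ≠ 0 := by
  subst hfill
  constructor
  · linarith
  · rw [h]; norm_num

end Summit.Ventures.CertifiedManyBodySolver.Cruxes.LowerEdge_ge_m4o5.OddDeformationGC
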